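import Summits.QuantumFields.BalabanUV.Beta.GAN24.FaceChargesOfWardLetters
import Summits.QuantumFields.BalabanUV.Beta.GAN24.FaceWWordVanishingOfWardLetters
import Summits.QuantumFields.BalabanUV.Beta.GAN24.ForcingFacePairFormAssembly

/-!
# `BalabanUV.Beta.GAN24.ForcingPairFormOfWardLetters` — binder row G-an2-4 ∕ (CONV-C), TRANSFER-III («slot the chain», the OWNER gan24-p1's `TRANSFER-III-SIZING.v0_7.md` §3(a),
# second option; R-gan24p1-g46-2): **road-P2's forcing pair form `hBF`, GIVEN THE F5 ANTISYMMETRIES, FOR ANY PACKED KERNEL CARRYING THE LETTERS (DG)(W-H)(W-M)(SG)(MO)(TG)** —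
# MY Part 50c `ForcingFacePairFormAssembly.forcingPairForm_dressedStep` RE-CUT OVER A GENERIC KERNEL `X`, and the instance at the COMB-CHART dressed step
# `X̃′_j := unitK s_f s_m (GcombSh Lc j)` of row D1's literal of record (III′) (G-an2-4 CRUX TEAM (2), leaf prover `b2b-balaban-gan24-formalise-leaf-02`, gen 78)

NOT IN PRINT; OUR BOOKKEEPING ([folklore] BY NAME over this gen's `FaceChargesOfWardLetters.faceRead_source_inl_inl_of_ward` (Part 47 from the letters),
`FaceWWordVanishingOfWardLetters.faceWWord_LS_eq_zero_of_ward` (Part 50b), `VertexFacePushOfWardLetters.tsum_faceBond_dM_of_ward ∕ exists_vertexFamily_dM_of_decays ∕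
dM_translate_coarse_of_shiftK` (Part 46), MY generic Part 49 `ForcingFacePairFormGlue.pairFormLS_of_threeWords`, Part 45 `FaceWordsDeepCurrents.summable_word_coarse(_right)`, Part 50a
`FaceWWordSummable.summable_faceWord_W2SymOfK_zero₂`, Part 50c's `ite_and_three`, an2's `SecondOrderResponse.vertexFamily₂_W2SymOfK'` and, for the instance, an2's (III′) letters
(`CombChartHColumnWard.colH_ward_GcombSh`, `CombChartWardSockets.colM_GcombSh_ward ∕ trK_GcombSh ∕ GcombSh_inr_inr_off`, `CombChartStepJets.decays_GcombSh ∕ shiftK_GcombSh`);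
0 `def`, 0 cited fact, 0 `def … : Prop`, 0 sorry).  HONEST FRAMING (cell contract, verbatim): «discharging `BetaPertH` makes Bałaban's UV stability UNCONDITIONAL — a real
constructive-QFT result; it is NOT the continuum limit and NOT the Clay problem.»  HONEST DEPENDENCY (verbatim): «continuum YM on T⁴ ⇐ BetaPertH ∧ nine spine estimates (0/9
proved); BetaPertH ⇐ (D1) ∧ (D4) ∧ CAP+tail; G-an2-4 gates asym, D1 and NE2/3/4.»

WHAT.  §1 **`forcingPairForm_of_ward`** (generic `d`, `Lc ≥ 1`, coarse period `P ≥ 1`, deep period `Lc·P`; `X : MKer (d+1) (Fib d)` with the six letters; ANY first tables `S`, `M`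
(local ∕ vertex family, `Lc`-block covariant, parity-odd rows), ANY mixed table `M₂` (`LocStencilFM`, block translation law), ANY `B` with vanishing `inl–inl` block, GIVEN the two F5
antisymmetries `hL` ∕ `hR` of `S` at the deep period): the `P`-face read `FF(μ,ν;α,β)` of `c•mmRead Lc (K3OfK X Lc S M W̃ μ r′ ν u′) + cB•B μ r′ ν u′`, `W̃ = W2SymOfK X Lc S M 0 M₂`, is an
`∃ T antisym²` pair form in road-P2's `hBF` spelling — MY Part 50c's proof token for token, the four (E) suppliers replaced by their letter forms (one constant `cH` for `(s_f s_m)·cH_j`).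
§2 THE (III′) INSTANCE **`forcingPairForm_combStep`** at `X̃′_j := unitK s_f s_m (GcombSh Lc j)` (ANY units, every `j`; no in-block-root hypothesis) — the (III′) twin of MY Part 50c, i.e.
the `(m, i)`-instance SHAPE of road-P2's `hBF` at the comb-chart data GIVEN `hL` ∕ `hR` there (leaf-04's F5 at (III′) — NOT in the tree, NOT asserted).
(E) is MY Part 50c, NOT restated.  Asserts NO value of any table; `hL` ∕ `hR` are hypotheses; discharges NOTHING of (C) ∕ (C)sym ∕ `hstep` ∕ `hB0` ∕ `hBF` ∕ `hSrc` ∕ `hSrcX` ∕ (Q-L) ∕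
`(hS, hSall)` ∕ `(hW, hWall)` at (E) or (III′) — the comb-chart TOWER's forcing tables are road-P2's to instantiate, the value ledger is untouched (engine first); NEVER «G-an2-4 closed»
as (CONV-C); NOT D1, NOT `BetaPertH`, NOT continuum, NOT Clay.  2026-08-25; no existing file touched.
-/

noncomputable section

open Finset
open scoped BigOperators
open Literature.MathematicalPhysics.QuantumFieldTheory
open Literature.MathematicalPhysics.QuantumFieldTheory.Balaban1983to89
open Literature.MathematicalPhysics.QuantumFieldTheory.Balaban1983to89.Beta
open Literature.Probability.LatticeModels (Torus.proj)
open B12Sec2to5 (l1)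
open B6BondElimination (unitVec)
open ExpKernelCalculus (Site MKer Decays BiLoc VertexFamily VertexFamily₂ shiftK comp)
open OneStepResolventKernel (Fib LocStencil biLoc_mono)
open BalabanCompositeJets (LocStencil₂)
open AffineAveraging (box toSite)
open OneStepKernelFamily (colH)
open SecondOrderResponse (colM dM K2OfK W2SymOfK LocStencilFM vertexFamily₂_W2SymOfK')
open BalabanStepW2 (K3OfK)
open BalabanStepJetsSucc (mmRead)
open BalabanStepJets (locStencil_mono)
open Summit.QuantumFields.BalabanUV.Beta.TameKernelCalculus (Loc trK)
open Summit.QuantumFields.BalabanUV.Beta.BorderedHessian (stepScale sgnK)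
open Summit.QuantumFields.BalabanUV.Beta.KernelWardRelative (gaugeWt)
open Summit.QuantumFields.BalabanUV.Beta.HessKerDressedUnits (unitK decays_unitK)
open Summit.QuantumFields.BalabanUV.Beta.GAN24.BiStencilZeroMode (Tab)
open Summit.QuantumFields.BalabanUV.Beta.GAN24.WSlotT2OfPieces (locStencil₂_zero)
open Summit.QuantumFields.BalabanUV.Beta.GAN24.FaceWordsDeepCurrents (summable_word_coarse summable_word_coarse_right)
open Summit.QuantumFields.BalabanUV.Beta.GAN24.ForcingFacePairFormGlue (pairFormLS_of_threeWords)
open Summit.QuantumFields.BalabanUV.Beta.GAN24.FaceWWordLetters (locStencilFM_mono)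
open Summit.QuantumFields.BalabanUV.Beta.GAN24.FaceWWordSummable (summable_faceWord_W2SymOfK_zero₂)
open Summit.QuantumFields.BalabanUV.Beta.GAN24.ForcingFacePairFormAssembly (ite_and_three)
open Summit.QuantumFields.BalabanUV.Beta.GAN24.ColumnResponseOfWardLetters (colH_ward_unitK colM_ward_unitK shiftK_unitK_of_shiftK)
open Summit.QuantumFields.BalabanUV.Beta.GAN24.VertexFacePushOfWardLetters (tsum_faceBond_dM_of_ward exists_vertexFamily_dM_of_decays dM_translate_coarse_of_shiftK)
open Summit.QuantumFields.BalabanUV.Beta.GAN24.FaceChargesOfWardLetters (faceRead_source_inl_inl_of_ward trK_combStep combStep_inr_inr_off)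
open Summit.QuantumFields.BalabanUV.Beta.GAN24.FaceWWordVanishingOfWardLetters (faceWWord_LS_eq_zero_of_ward)
open Summit.QuantumFields.BalabanUV.Beta.CombChartStepJets (GcombSh decays_GcombSh shiftK_GcombSh)
open Summit.QuantumFields.BalabanUV.Beta.CombChartHColumnWard (colH_ward_GcombSh)
open Summit.QuantumFields.BalabanUV.Beta.CombChartWardSockets (colM_GcombSh_ward)

namespace Summit.QuantumFields.BalabanUV.Beta.GAN24.ForcingPairFormOfWardLetters

variable {d : ℕ} {Lc : ℕ} [NeZero Lc]

/-! ## §1 road-P2's `hBF` shape for a kernel with the letters, given F5's `hL` ∕ `hR` -/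

section Ward

variable {X : MKer (d + 1) (Fib d)} {CK δK cH : ℝ}

set_option maxHeartbeats 400000 in
/-- NOT IN PRINT; OUR BOOKKEEPING.  **road-P2's FORCING PAIR FORM `hBF` FOR A KERNEL WITH THE LETTERS, GIVEN F5's ANTISYMMETRIES** — MY Part 50c token for token (statement literal =
road-P2's `hBF` spelling; `maxHeartbeats 400000` for this one declaration as in Part 50c v1.1, the statement elaborating near the default budget). -/
theorem forcingPairForm_of_ward (hX : Decays X CK δK) (hδK : 0 < δK)
    (hHw : ∀ (y : Site (d + 1)) (κ : Fin (d + 1)) (u : Site (d + 1)),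
      ∑ μ, (colH X Lc μ (y - unitVec μ) κ u - colH X Lc μ y κ u) = cH * gaugeWt Lc y κ u)
    (hMw : ∀ (y : Site (d + 1)) (ρ : Fin (d + 1)) (w : Site (d + 1)), ∑ μ, (colM X Lc μ (y - unitVec μ) ρ w - colM X Lc μ y ρ w) = 0)
    (hXsg : trK X = sgnK X) (hXoff : ∀ (w z : Site (d + 1)) (ρ μ : Fin (d + 1)), Torus.proj Lc w ≠ 0 → X w z (Sum.inr ρ) (Sum.inr μ) = 0)
    (hXs : ∀ t : Site (d + 1), shiftK (-((Lc : ℤ) • t)) X = X) {P : ℕ} (hP : 1 ≤ P)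
    {S M : Fin (d + 1) → Site (d + 1) → MKer (d + 1) (Fib d)} {Cs δs CM δM : ℝ}
    (hS : LocStencil S Cs δs) (hδs : 0 < δs) (hM : VertexFamily M Lc CM δM) (hδM : 0 < δM)
    (hSt : ∀ (κ : Fin (d + 1)) (u t : Site (d + 1)), S κ (u + (Lc : ℤ) • t) = shiftK (-((Lc : ℤ) • t)) (S κ u))
    (hMt : ∀ (ρ : Fin (d + 1)) (w t : Site (d + 1)), M ρ (w + t) = shiftK (-((Lc : ℤ) • t)) (M ρ w))
    (hSrow : ∀ κ u, trK (S κ u) = -sgnK (S κ u)) (hMrow : ∀ ρ w, trK (M ρ w) = -sgnK (M ρ w))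
    {M₂ : Fin (d + 1) → Site (d + 1) → Fin (d + 1) → Site (d + 1) → MKer (d + 1) (Fib d)} {C₂ δ₂ : ℝ} (hM₂ : LocStencilFM Lc M₂ C₂ δ₂) (hδ₂ : 0 < δ₂)
    (hM₂t : ∀ (κ : Fin (d + 1)) (u : Site (d + 1)) (ρ : Fin (d + 1)) (w t : Site (d + 1)), M₂ κ (u + (Lc : ℤ) • t) ρ (w + t) = shiftK (-((Lc : ℤ) • t)) (M₂ κ u ρ w))
    {B : Tab d} (hBff : ∀ κ u κ' u' x z (α β : Fin (d + 1)), B κ u κ' u' x z (Sum.inl α) (Sum.inl β) = 0) (c cB : ℝ)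
    (hL : ∀ (ν β : Fin (d + 1)) (p : Site (d + 1)) (a' : Fib d),
      (∑' q : Site (d + 1), (if q β % ((Lc * P : ℕ) : ℤ) = ((Lc * P : ℕ) : ℤ) - 1 then (1 : ℝ) else 0) *
          ∑' u : Site (d + 1), (if u ν % ((Lc * P : ℕ) : ℤ) = ((Lc * P : ℕ) : ℤ) - 1 then (1 : ℝ) else 0) * S ν u q p (Sum.inl β) a') +
        (∑' q : Site (d + 1), (if q ν % ((Lc * P : ℕ) : ℤ) = ((Lc * P : ℕ) : ℤ) - 1 then (1 : ℝ) else 0) *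
          ∑' u : Site (d + 1), (if u β % ((Lc * P : ℕ) : ℤ) = ((Lc * P : ℕ) : ℤ) - 1 then (1 : ℝ) else 0) * S β u q p (Sum.inl ν) a') = 0)
    (hR : ∀ (μ ν : Fin (d + 1)) (s : Site (d + 1)) (f : Fib d),
      (∑' s' : Site (d + 1), (if s' ν % ((Lc * P : ℕ) : ℤ) = ((Lc * P : ℕ) : ℤ) - 1 then (1 : ℝ) else 0) *
          ∑' t' : Site (d + 1), (if t' μ % ((Lc * P : ℕ) : ℤ) = ((Lc * P : ℕ) : ℤ) - 1 then (1 : ℝ) else 0) * S μ t' s s' f (Sum.inl ν)) +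
        (∑' s' : Site (d + 1), (if s' μ % ((Lc * P : ℕ) : ℤ) = ((Lc * P : ℕ) : ℤ) - 1 then (1 : ℝ) else 0) *
          ∑' t' : Site (d + 1), (if t' ν % ((Lc * P : ℕ) : ℤ) = ((Lc * P : ℕ) : ℤ) - 1 then (1 : ℝ) else 0) * S ν t' s s' f (Sum.inl μ)) = 0) :
    ∃ T : Fin (d + 1) → Fin (d + 1) → Fin (d + 1) → Fin (d + 1) → ℝ,
      (∀ a b c e, T b a c e = -T a b c e) ∧ (∀ a b c e, T a b e c = -T a b c e) ∧
      ∀ κ κ' κ₁ κ₂ : Fin (d + 1),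
        ((fun μ ν α β : Fin (d + 1) => ∑ r' ∈ box (d + 1) P, ∑' u' : Site (d + 1), ∑' x : Site (d + 1), ∑' z : Site (d + 1),
            (if toSite r' μ % (P : ℤ) = (P : ℤ) - 1 ∧ u' ν % (P : ℤ) = (P : ℤ) - 1 ∧ x α % (P : ℤ) = (P : ℤ) - 1 ∧ z β % (P : ℤ) = (P : ℤ) - 1 then
              (c • mmRead Lc (K3OfK X Lc S M
                  (W2SymOfK X Lc S M 0 M₂) μ (toSite r') ν u')
                + cB • B μ (toSite r') ν u') x z (Sum.inl α) (Sum.inl β) else 0)) κ κ' κ₁ κ₂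
          + (fun μ ν α β : Fin (d + 1) => ∑ r' ∈ box (d + 1) P, ∑' u' : Site (d + 1), ∑' x : Site (d + 1), ∑' z : Site (d + 1),
            (if toSite r' μ % (P : ℤ) = (P : ℤ) - 1 ∧ u' ν % (P : ℤ) = (P : ℤ) - 1 ∧ x α % (P : ℤ) = (P : ℤ) - 1 ∧ z β % (P : ℤ) = (P : ℤ) - 1 then
              (c • mmRead Lc (K3OfK X Lc S M
                  (W2SymOfK X Lc S M 0 M₂) μ (toSite r') ν u')
                + cB • B μ (toSite r') ν u') x z (Sum.inl α) (Sum.inl β) else 0)) κ' κ κ₁ κ₂)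
        + ((fun μ ν α β : Fin (d + 1) => ∑ r' ∈ box (d + 1) P, ∑' u' : Site (d + 1), ∑' x : Site (d + 1), ∑' z : Site (d + 1),
            (if toSite r' μ % (P : ℤ) = (P : ℤ) - 1 ∧ u' ν % (P : ℤ) = (P : ℤ) - 1 ∧ x α % (P : ℤ) = (P : ℤ) - 1 ∧ z β % (P : ℤ) = (P : ℤ) - 1 then
              (c • mmRead Lc (K3OfK X Lc S M
                  (W2SymOfK X Lc S M 0 M₂) μ (toSite r') ν u')
                + cB • B μ (toSite r') ν u') x z (Sum.inl α) (Sum.inl β) else 0)) κ' κ κ₁ κ₂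
          + (fun μ ν α β : Fin (d + 1) => ∑ r' ∈ box (d + 1) P, ∑' u' : Site (d + 1), ∑' x : Site (d + 1), ∑' z : Site (d + 1),
            (if toSite r' μ % (P : ℤ) = (P : ℤ) - 1 ∧ u' ν % (P : ℤ) = (P : ℤ) - 1 ∧ x α % (P : ℤ) = (P : ℤ) - 1 ∧ z β % (P : ℤ) = (P : ℤ) - 1 then
              (c • mmRead Lc (K3OfK X Lc S M
                  (W2SymOfK X Lc S M 0 M₂) μ (toSite r') ν u')
                + cB • B μ (toSite r') ν u') x z (Sum.inl α) (Sum.inl β) else 0)) κ κ' κ₁ κ₂)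
        + (((fun μ ν α β : Fin (d + 1) => ∑ r' ∈ box (d + 1) P, ∑' u' : Site (d + 1), ∑' x : Site (d + 1), ∑' z : Site (d + 1),
            (if toSite r' μ % (P : ℤ) = (P : ℤ) - 1 ∧ u' ν % (P : ℤ) = (P : ℤ) - 1 ∧ x α % (P : ℤ) = (P : ℤ) - 1 ∧ z β % (P : ℤ) = (P : ℤ) - 1 then
              (c • mmRead Lc (K3OfK X Lc S M
                  (W2SymOfK X Lc S M 0 M₂) μ (toSite r') ν u')
                + cB • B μ (toSite r') ν u') x z (Sum.inl α) (Sum.inl β) else 0)) κ κ' κ₂ κ₁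
          + (fun μ ν α β : Fin (d + 1) => ∑ r' ∈ box (d + 1) P, ∑' u' : Site (d + 1), ∑' x : Site (d + 1), ∑' z : Site (d + 1),
            (if toSite r' μ % (P : ℤ) = (P : ℤ) - 1 ∧ u' ν % (P : ℤ) = (P : ℤ) - 1 ∧ x α % (P : ℤ) = (P : ℤ) - 1 ∧ z β % (P : ℤ) = (P : ℤ) - 1 then
              (c • mmRead Lc (K3OfK X Lc S M
                  (W2SymOfK X Lc S M 0 M₂) μ (toSite r') ν u')
                + cB • B μ (toSite r') ν u') x z (Sum.inl α) (Sum.inl β) else 0)) κ' κ κ₂ κ₁)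
        + ((fun μ ν α β : Fin (d + 1) => ∑ r' ∈ box (d + 1) P, ∑' u' : Site (d + 1), ∑' x : Site (d + 1), ∑' z : Site (d + 1),
            (if toSite r' μ % (P : ℤ) = (P : ℤ) - 1 ∧ u' ν % (P : ℤ) = (P : ℤ) - 1 ∧ x α % (P : ℤ) = (P : ℤ) - 1 ∧ z β % (P : ℤ) = (P : ℤ) - 1 then
              (c • mmRead Lc (K3OfK X Lc S M
                  (W2SymOfK X Lc S M 0 M₂) μ (toSite r') ν u')
                + cB • B μ (toSite r') ν u') x z (Sum.inl α) (Sum.inl β) else 0)) κ' κ κ₂ κ₁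
          + (fun μ ν α β : Fin (d + 1) => ∑ r' ∈ box (d + 1) P, ∑' u' : Site (d + 1), ∑' x : Site (d + 1), ∑' z : Site (d + 1),
            (if toSite r' μ % (P : ℤ) = (P : ℤ) - 1 ∧ u' ν % (P : ℤ) = (P : ℤ) - 1 ∧ x α % (P : ℤ) = (P : ℤ) - 1 ∧ z β % (P : ℤ) = (P : ℤ) - 1 then
              (c • mmRead Lc (K3OfK X Lc S M
                  (W2SymOfK X Lc S M 0 M₂) μ (toSite r') ν u')
                + cB • B μ (toSite r') ν u') x z (Sum.inl α) (Sum.inl β) else 0)) κ κ' κ₂ κ₁))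
          = T κ κ₁ κ' κ₂ + T κ' κ₁ κ κ₂ + (T κ κ₂ κ' κ₁ + T κ' κ₂ κ κ₁) := by
  classical
  haveI : NeZero P := ⟨by omega⟩
  have hLc : 1 ≤ Lc := Nat.one_le_iff_ne_zero.2 (NeZero.ne Lc)
  haveI : NeZero (Lc * P) := ⟨(Nat.mul_pos (by omega) (by omega)).ne'⟩
  -- the kernel: decay and `Lc`-block periodicity are the letters (DG), (TG)
  have hCK0 : 0 ≤ CK := hX.nonneg (Sum.inl 0)
  have esmul : ∀ s : Site (d + 1), ((Lc * P : ℕ) : ℤ) • s = (Lc : ℤ) • ((P : ℤ) • s) := by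
    intro s; rw [smul_smul, Nat.cast_mul]
  have hXt : ∀ s : Site (d + 1), shiftK (-(((Lc * P : ℕ) : ℤ) • s)) X = X := by
    intro s; rw [esmul]; exact hXs ((P : ℤ) • s)
  have hStN : ∀ (κ : Fin (d + 1)) (t s : Site (d + 1)), S κ (t + ((Lc * P : ℕ) : ℤ) • s) = shiftK (-(((Lc * P : ℕ) : ℤ) • s)) (S κ t) := by
    intro κ t s; rw [esmul]; exact hSt κ t ((P : ℤ) • s)
  -- the dressed vertex family and a common rate
  obtain ⟨CD, δD, hδD, hV⟩ := exists_vertexFamily_dM_of_decays (Lc := Lc) hX hδK hS hδs hM hδM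
  have hCs : 0 ≤ Cs := (hS 0 0).nonneg (Sum.inl 0)
  have hCM : 0 ≤ CM := (hM 0 0).nonneg (Sum.inl 0)
  have hCD : 0 ≤ CD := (hV 0 0).nonneg (Sum.inl 0)
  have hC₂ : 0 ≤ C₂ := hM₂.nonneg
  set m₀ : ℝ := min (min (min (min δK δs) δM) δ₂) δD with hm₀
  have hm0 : 0 < m₀ := lt_min (lt_min (lt_min (lt_min hδK hδs) hδM) hδ₂) hδD
  have hKm : Decays X CK m₀ :=
    OneStepResolventKernel.decays_mono hX hCK0 le_rfl
      ((min_le_left _ _).trans ((min_le_left _ _).trans ((min_le_left _ _).trans (min_le_left _ _))))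
  have hSm : LocStencil S Cs m₀ :=
    locStencil_mono hS hCs ((min_le_left _ _).trans ((min_le_left _ _).trans ((min_le_left _ _).trans (min_le_right _ _))))
  have hMm : VertexFamily M Lc CM m₀ := BalabanStepW2.vertexFamily_mono' hM hCM ((min_le_left _ _).trans ((min_le_left _ _).trans (min_le_right _ _)))
  have hM₂m : LocStencilFM Lc M₂ C₂ m₀ := locStencilFM_mono hM₂ hC₂ ((min_le_left _ _).trans (min_le_right _ _))
  have hDm : ∀ (κ : Fin (d + 1)) (u : Site (d + 1)),
      BiLoc (dM X Lc S M κ u) ((Lc : ℤ) • u) ((Lc : ℤ) • u) CD m₀ :=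
    fun κ u => biLoc_mono (hV κ u) hCD (min_le_right _ _)
  -- `Loc` of the two dressed letters (Part 47's hypotheses)
  have hb : ∀ (κ : Fin (d + 1)) (y : Site (d + 1)), Loc (dM X Lc S M κ y) :=
    fun κ y => ⟨_, _, _, _, hδD, hV κ y⟩
  obtain ⟨Cw, δw, hδw, hVW⟩ := vertexFamily₂_W2SymOfK' (N := Lc) ⟨δK, _, hδK, hCK0, hX⟩ hS hδs hM hδM (locStencil₂_zero (d := d) 1) one_pos hM₂ hδ₂
  have hW : ∀ (κ : Fin (d + 1)) (y : Site (d + 1)) (κ' : Fin (d + 1)) (y' : Site (d + 1)),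
      Loc (W2SymOfK X Lc S M 0 M₂ κ y κ' y') :=
    fun κ y κ' y' => ⟨_, _, _, _, hδw, hVW κ y κ' y'⟩
  -- masks
  have hχ : ∀ s : ℤ, |(fun s : ℤ => if s % (P : ℤ) = (P : ℤ) - 1 then (1 : ℝ) else 0) s| ≤ 1 := by
    intro s; simp only; split_ifs <;> simp
  have hχχ : ∀ (A : Prop) [Decidable A] (ν : Fin (d + 1)) (u' : Site (d + 1)),
      |(fun u' : Site (d + 1) => (if A then (1 : ℝ) else 0) * (if u' ν % (P : ℤ) = (P : ℤ) - 1 then (1 : ℝ) else 0)) u'| ≤ 1 := by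
    intro A _ ν u'; simp only; split_ifs <;> simp
  have hmm : ∀ (α β : Fin (d + 1)) (yw : Site (d + 1) × Site (d + 1)),
      |(fun yw : Site (d + 1) × Site (d + 1) => (if yw.1 α % ((Lc * P : ℕ) : ℤ) = ((Lc * P : ℕ) : ℤ) - 1 then (1 : ℝ) else 0) *
        (if yw.2 β % ((Lc * P : ℕ) : ℤ) = ((Lc * P : ℕ) : ℤ) - 1 then (1 : ℝ) else 0)) yw| ≤ 1 := by
    intro α β yw; simp only; split_ifs <;> simp
  have hLP : (Lc : ℤ) * (P : ℤ) = ((Lc * P : ℕ) : ℤ) := by push_cast; ring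
  -- the three-word display (Part 47, split by the free-bond summabilities)
  have hdisp : ∀ μ ν α β : Fin (d + 1),
      (∑ r' ∈ box (d + 1) P, ∑' u' : Site (d + 1), ∑' x : Site (d + 1), ∑' z : Site (d + 1),
          (if toSite r' μ % (P : ℤ) = (P : ℤ) - 1 ∧ u' ν % (P : ℤ) = (P : ℤ) - 1 ∧ x α % (P : ℤ) = (P : ℤ) - 1 ∧ z β % (P : ℤ) = (P : ℤ) - 1 then
            (c • mmRead Lc (K3OfK X Lc S M
                (W2SymOfK X Lc S M 0 M₂) μ (toSite r') ν u')
              + cB • B μ (toSite r') ν u') x z (Sum.inl α) (Sum.inl β) else 0))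
        = c * -((cH) * (cH)) *
          ((∑ r' ∈ box (d + 1) P, ∑' u' : Site (d + 1), (if toSite r' μ % (P : ℤ) = (P : ℤ) - 1 then (1 : ℝ) else 0) * (if u' ν % (P : ℤ) = (P : ℤ) - 1 then (1 : ℝ) else 0) *
              ∑' yw : Site (d + 1) × Site (d + 1), ((if yw.1 α % ((Lc * P : ℕ) : ℤ) = ((Lc * P : ℕ) : ℤ) - 1 then (1 : ℝ) else 0) *
                  (if yw.2 β % ((Lc * P : ℕ) : ℤ) = ((Lc * P : ℕ) : ℤ) - 1 then (1 : ℝ) else 0)) *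
                comp (comp (dM X Lc S M μ (toSite r'))
                  X)
                  (dM X Lc S M ν u') yw.1 yw.2 (Sum.inl α) (Sum.inl β)) +
           (∑ r' ∈ box (d + 1) P, ∑' u' : Site (d + 1), (if toSite r' μ % (P : ℤ) = (P : ℤ) - 1 then (1 : ℝ) else 0) * (if u' ν % (P : ℤ) = (P : ℤ) - 1 then (1 : ℝ) else 0) *
              ∑' yw : Site (d + 1) × Site (d + 1), ((if yw.1 α % ((Lc * P : ℕ) : ℤ) = ((Lc * P : ℕ) : ℤ) - 1 then (1 : ℝ) else 0) *
                  (if yw.2 β % ((Lc * P : ℕ) : ℤ) = ((Lc * P : ℕ) : ℤ) - 1 then (1 : ℝ) else 0)) *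
                comp (comp (dM X Lc S M ν u')
                  X)
                  (dM X Lc S M μ (toSite r')) yw.1 yw.2 (Sum.inl α) (Sum.inl β)) -
           (∑ r' ∈ box (d + 1) P, ∑' u' : Site (d + 1), (if toSite r' μ % (P : ℤ) = (P : ℤ) - 1 then (1 : ℝ) else 0) * (if u' ν % (P : ℤ) = (P : ℤ) - 1 then (1 : ℝ) else 0) *
              ∑' yw : Site (d + 1) × Site (d + 1), (if yw.1 α % ((Lc * P : ℕ) : ℤ) = ((Lc * P : ℕ) : ℤ) - 1 then (1 : ℝ) else 0) *
                  (if yw.2 β % ((Lc * P : ℕ) : ℤ) = ((Lc * P : ℕ) : ℤ) - 1 then (1 : ℝ) else 0) *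
                W2SymOfK X Lc S M 0 M₂ μ (toSite r') ν u' yw.1 yw.2
                  (Sum.inl α) (Sum.inl β))) := by
    intro μ ν α β
    have h47 := faceRead_source_inl_inl_of_ward (d := d) hX hδK hHw hMw hXsg hXoff hP
      (W := W2SymOfK X Lc S M 0 M₂) (B := B) c cB hb hW hBff μ ν α β
    simp only [hLP] at h47
    rw [h47]
    congr 1
    -- free-bond summabilities of the three words
    have Sa : ∀ r' : Fin (d + 1) → ℕ, Summable fun u' : Site (d + 1) =>
        (if toSite r' μ % (P : ℤ) = (P : ℤ) - 1 then (1 : ℝ) else 0) * (if u' ν % (P : ℤ) = (P : ℤ) - 1 then (1 : ℝ) else 0) *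
          ∑' yw : Site (d + 1) × Site (d + 1), ((if yw.1 α % ((Lc * P : ℕ) : ℤ) = ((Lc * P : ℕ) : ℤ) - 1 then (1 : ℝ) else 0) *
              (if yw.2 β % ((Lc * P : ℕ) : ℤ) = ((Lc * P : ℕ) : ℤ) - 1 then (1 : ℝ) else 0)) *
            comp (comp (dM X Lc S M μ (toSite r'))
              X)
              (dM X Lc S M ν u') yw.1 yw.2 (Sum.inl α) (Sum.inl β) :=
      fun r' => summable_word_coarse_right (D := dM X Lc S M) hLc
        (hDm μ (toSite r')) hKm hm0 hDm ν _ (hχχ _ ν) _ (hmm α β) (Sum.inl α) (Sum.inl β)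
    have Sb : ∀ r' : Fin (d + 1) → ℕ, Summable fun u' : Site (d + 1) =>
        (if toSite r' μ % (P : ℤ) = (P : ℤ) - 1 then (1 : ℝ) else 0) * (if u' ν % (P : ℤ) = (P : ℤ) - 1 then (1 : ℝ) else 0) *
          ∑' yw : Site (d + 1) × Site (d + 1), ((if yw.1 α % ((Lc * P : ℕ) : ℤ) = ((Lc * P : ℕ) : ℤ) - 1 then (1 : ℝ) else 0) *
              (if yw.2 β % ((Lc * P : ℕ) : ℤ) = ((Lc * P : ℕ) : ℤ) - 1 then (1 : ℝ) else 0)) *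
            comp (comp (dM X Lc S M ν u')
              X)
              (dM X Lc S M μ (toSite r')) yw.1 yw.2 (Sum.inl α) (Sum.inl β) :=
      fun r' => summable_word_coarse (D := dM X Lc S M) hLc
        (hDm μ (toSite r')) hKm hm0 hDm ν _ (hχχ _ ν) _ (hmm α β) (Sum.inl α) (Sum.inl β)
    have Sw : ∀ r' : Fin (d + 1) → ℕ, Summable fun u' : Site (d + 1) =>
        (if toSite r' μ % (P : ℤ) = (P : ℤ) - 1 then (1 : ℝ) else 0) * (if u' ν % (P : ℤ) = (P : ℤ) - 1 then (1 : ℝ) else 0) *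
          ∑' yw : Site (d + 1) × Site (d + 1), (if yw.1 α % ((Lc * P : ℕ) : ℤ) = ((Lc * P : ℕ) : ℤ) - 1 then (1 : ℝ) else 0) *
              (if yw.2 β % ((Lc * P : ℕ) : ℤ) = ((Lc * P : ℕ) : ℤ) - 1 then (1 : ℝ) else 0) *
            W2SymOfK X Lc S M 0 M₂ μ (toSite r') ν u' yw.1 yw.2
              (Sum.inl α) (Sum.inl β) :=
      fun r' => summable_faceWord_W2SymOfK_zero₂ (N := Lc) hLc hKm hCK0 hm0 hSm hMm hM₂m μ (toSite r') ν _ (hχχ _ ν) _ α β (Sum.inl α) (Sum.inl β)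
    rw [← Finset.sum_add_distrib, ← Finset.sum_sub_distrib]
    refine Finset.sum_congr rfl fun r' _ => ?_
    rw [← (Sa r').tsum_add (Sb r'), ← ((Sa r').add (Sb r')).tsum_sub (Sw r')]
    refine tsum_congr fun u' => ?_
    rw [ite_and_three]
  -- Part 49
  have h49 := pairFormLS_of_threeWords (d := d) (Lc := Lc) (P := P) (N := Lc * P)
    (X := X)
    (D := dM X Lc S M) (S := S)
    hLc hKm hXt hm0 hDm (fun κ u s => dM_translate_coarse_of_shiftK hXs P hSt hMt κ u s) hSm hStN
    (cH)
    (fun κ x z a b => tsum_faceBond_dM_of_ward hX hδK hHw hMw κ hP hS hδs hM hδM x z a b) hL hR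
    (c * -((cH) * (cH)))
    (F := fun μ ν α β : Fin (d + 1) => ∑ r' ∈ box (d + 1) P, ∑' u' : Site (d + 1), ∑' x : Site (d + 1), ∑' z : Site (d + 1),
      (if toSite r' μ % (P : ℤ) = (P : ℤ) - 1 ∧ u' ν % (P : ℤ) = (P : ℤ) - 1 ∧ x α % (P : ℤ) = (P : ℤ) - 1 ∧ z β % (P : ℤ) = (P : ℤ) - 1 then
        (c • mmRead Lc (K3OfK X Lc S M
            (W2SymOfK X Lc S M 0 M₂) μ (toSite r') ν u')
          + cB • B μ (toSite r') ν u') x z (Sum.inl α) (Sum.inl β) else 0))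
    (Ww := fun μ ν α β : Fin (d + 1) => ∑ r' ∈ box (d + 1) P, ∑' u' : Site (d + 1),
      (if toSite r' μ % (P : ℤ) = (P : ℤ) - 1 then (1 : ℝ) else 0) * (if u' ν % (P : ℤ) = (P : ℤ) - 1 then (1 : ℝ) else 0) *
        ∑' yw : Site (d + 1) × Site (d + 1), (if yw.1 α % ((Lc * P : ℕ) : ℤ) = ((Lc * P : ℕ) : ℤ) - 1 then (1 : ℝ) else 0) *
            (if yw.2 β % ((Lc * P : ℕ) : ℤ) = ((Lc * P : ℕ) : ℤ) - 1 then (1 : ℝ) else 0) *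
          W2SymOfK X Lc S M 0 M₂ μ (toSite r') ν u' yw.1 yw.2
            (Sum.inl α) (Sum.inl β))
    (fun μ ν α β => hdisp μ ν α β)
    (faceWWord_LS_eq_zero_of_ward (d := d) hX hδK hMw hXs (P := P) hS hδs hM hδM hSrow hMrow hM₂ hδ₂ hM₂t (((Lc * P : ℕ) : ℤ)) ⟨1, by push_cast; ring⟩)
  exact h49

end Ward

/-! ## §2 The (III′) instance `X̃′_j = unitK s_f s_m (GcombSh Lc j)` -/

section CombStep

variable (Lc)

set_option maxHeartbeats 400000 in
/-- NOT IN PRINT; OUR BOOKKEEPING.  **(III′) — road-P2's `hBF` SHAPE AT THE COMB-CHART DRESSED STEP, GIVEN F5's `hL` ∕ `hR` THERE** (every `j`, ANY units, `1 ≤ P`) — §1 at an2's (III′)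
letters; the (III′) twin of MY Part 50c `forcingPairForm_dressedStep`.  `hL` ∕ `hR` (leaf-04's F5 at the comb-chart data) are HYPOTHESES, not in the tree. -/
theorem forcingPairForm_combStep (sf sm : ℝ) (j : ℕ) {P : ℕ} (hP : 1 ≤ P)
    {S M : Fin (d + 1) → Site (d + 1) → MKer (d + 1) (Fib d)} {Cs δs CM δM : ℝ}
    (hS : LocStencil S Cs δs) (hδs : 0 < δs) (hM : VertexFamily M Lc CM δM) (hδM : 0 < δM)
    (hSt : ∀ (κ : Fin (d + 1)) (u t : Site (d + 1)), S κ (u + (Lc : ℤ) • t) = shiftK (-((Lc : ℤ) • t)) (S κ u))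
    (hMt : ∀ (ρ : Fin (d + 1)) (w t : Site (d + 1)), M ρ (w + t) = shiftK (-((Lc : ℤ) • t)) (M ρ w))
    (hSrow : ∀ κ u, trK (S κ u) = -sgnK (S κ u)) (hMrow : ∀ ρ w, trK (M ρ w) = -sgnK (M ρ w))
    {M₂ : Fin (d + 1) → Site (d + 1) → Fin (d + 1) → Site (d + 1) → MKer (d + 1) (Fib d)} {C₂ δ₂ : ℝ} (hM₂ : LocStencilFM Lc M₂ C₂ δ₂) (hδ₂ : 0 < δ₂)
    (hM₂t : ∀ (κ : Fin (d + 1)) (u : Site (d + 1)) (ρ : Fin (d + 1)) (w t : Site (d + 1)), M₂ κ (u + (Lc : ℤ) • t) ρ (w + t) = shiftK (-((Lc : ℤ) • t)) (M₂ κ u ρ w))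
    {B : Tab d} (hBff : ∀ κ u κ' u' x z (α β : Fin (d + 1)), B κ u κ' u' x z (Sum.inl α) (Sum.inl β) = 0) (c cB : ℝ)
    (hL : ∀ (ν β : Fin (d + 1)) (p : Site (d + 1)) (a' : Fib d),
      (∑' q : Site (d + 1), (if q β % ((Lc * P : ℕ) : ℤ) = ((Lc * P : ℕ) : ℤ) - 1 then (1 : ℝ) else 0) *
          ∑' u : Site (d + 1), (if u ν % ((Lc * P : ℕ) : ℤ) = ((Lc * P : ℕ) : ℤ) - 1 then (1 : ℝ) else 0) * S ν u q p (Sum.inl β) a') +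
        (∑' q : Site (d + 1), (if q ν % ((Lc * P : ℕ) : ℤ) = ((Lc * P : ℕ) : ℤ) - 1 then (1 : ℝ) else 0) *
          ∑' u : Site (d + 1), (if u β % ((Lc * P : ℕ) : ℤ) = ((Lc * P : ℕ) : ℤ) - 1 then (1 : ℝ) else 0) * S β u q p (Sum.inl ν) a') = 0)
    (hR : ∀ (μ ν : Fin (d + 1)) (s : Site (d + 1)) (f : Fib d),
      (∑' s' : Site (d + 1), (if s' ν % ((Lc * P : ℕ) : ℤ) = ((Lc * P : ℕ) : ℤ) - 1 then (1 : ℝ) else 0) *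
          ∑' t' : Site (d + 1), (if t' μ % ((Lc * P : ℕ) : ℤ) = ((Lc * P : ℕ) : ℤ) - 1 then (1 : ℝ) else 0) * S μ t' s s' f (Sum.inl ν)) +
        (∑' s' : Site (d + 1), (if s' μ % ((Lc * P : ℕ) : ℤ) = ((Lc * P : ℕ) : ℤ) - 1 then (1 : ℝ) else 0) *
          ∑' t' : Site (d + 1), (if t' ν % ((Lc * P : ℕ) : ℤ) = ((Lc * P : ℕ) : ℤ) - 1 then (1 : ℝ) else 0) * S ν t' s s' f (Sum.inl μ)) = 0) :
    ∃ T : Fin (d + 1) → Fin (d + 1) → Fin (d + 1) → Fin (d + 1) → ℝ,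
      (∀ a b c e, T b a c e = -T a b c e) ∧ (∀ a b c e, T a b e c = -T a b c e) ∧
      ∀ κ κ' κ₁ κ₂ : Fin (d + 1),
        ((fun μ ν α β : Fin (d + 1) => ∑ r' ∈ box (d + 1) P, ∑' u' : Site (d + 1), ∑' x : Site (d + 1), ∑' z : Site (d + 1),
            (if toSite r' μ % (P : ℤ) = (P : ℤ) - 1 ∧ u' ν % (P : ℤ) = (P : ℤ) - 1 ∧ x α % (P : ℤ) = (P : ℤ) - 1 ∧ z β % (P : ℤ) = (P : ℤ) - 1 then
              (c • mmRead Lc (K3OfK (unitK sf sm (GcombSh (d := d) Lc j)) Lc S M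
                  (W2SymOfK (unitK sf sm (GcombSh (d := d) Lc j)) Lc S M 0 M₂) μ (toSite r') ν u')
                + cB • B μ (toSite r') ν u') x z (Sum.inl α) (Sum.inl β) else 0)) κ κ' κ₁ κ₂
          + (fun μ ν α β : Fin (d + 1) => ∑ r' ∈ box (d + 1) P, ∑' u' : Site (d + 1), ∑' x : Site (d + 1), ∑' z : Site (d + 1),
            (if toSite r' μ % (P : ℤ) = (P : ℤ) - 1 ∧ u' ν % (P : ℤ) = (P : ℤ) - 1 ∧ x α % (P : ℤ) = (P : ℤ) - 1 ∧ z β % (P : ℤ) = (P : ℤ) - 1 then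
              (c • mmRead Lc (K3OfK (unitK sf sm (GcombSh (d := d) Lc j)) Lc S M
                  (W2SymOfK (unitK sf sm (GcombSh (d := d) Lc j)) Lc S M 0 M₂) μ (toSite r') ν u')
                + cB • B μ (toSite r') ν u') x z (Sum.inl α) (Sum.inl β) else 0)) κ' κ κ₁ κ₂)
        + ((fun μ ν α β : Fin (d + 1) => ∑ r' ∈ box (d + 1) P, ∑' u' : Site (d + 1), ∑' x : Site (d + 1), ∑' z : Site (d + 1),
            (if toSite r' μ % (P : ℤ) = (P : ℤ) - 1 ∧ u' ν % (P : ℤ) = (P : ℤ) - 1 ∧ x α % (P : ℤ) = (P : ℤ) - 1 ∧ z β % (P : ℤ) = (P : ℤ) - 1 then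
              (c • mmRead Lc (K3OfK (unitK sf sm (GcombSh (d := d) Lc j)) Lc S M
                  (W2SymOfK (unitK sf sm (GcombSh (d := d) Lc j)) Lc S M 0 M₂) μ (toSite r') ν u')
                + cB • B μ (toSite r') ν u') x z (Sum.inl α) (Sum.inl β) else 0)) κ' κ κ₁ κ₂
          + (fun μ ν α β : Fin (d + 1) => ∑ r' ∈ box (d + 1) P, ∑' u' : Site (d + 1), ∑' x : Site (d + 1), ∑' z : Site (d + 1),
            (if toSite r' μ % (P : ℤ) = (P : ℤ) - 1 ∧ u' ν % (P : ℤ) = (P : ℤ) - 1 ∧ x α % (P : ℤ) = (P : ℤ) - 1 ∧ z β % (P : ℤ) = (P : ℤ) - 1 then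
              (c • mmRead Lc (K3OfK (unitK sf sm (GcombSh (d := d) Lc j)) Lc S M
                  (W2SymOfK (unitK sf sm (GcombSh (d := d) Lc j)) Lc S M 0 M₂) μ (toSite r') ν u')
                + cB • B μ (toSite r') ν u') x z (Sum.inl α) (Sum.inl β) else 0)) κ κ' κ₁ κ₂)
        + (((fun μ ν α β : Fin (d + 1) => ∑ r' ∈ box (d + 1) P, ∑' u' : Site (d + 1), ∑' x : Site (d + 1), ∑' z : Site (d + 1),
            (if toSite r' μ % (P : ℤ) = (P : ℤ) - 1 ∧ u' ν % (P : ℤ) = (P : ℤ) - 1 ∧ x α % (P : ℤ) = (P : ℤ) - 1 ∧ z β % (P : ℤ) = (P : ℤ) - 1 then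
              (c • mmRead Lc (K3OfK (unitK sf sm (GcombSh (d := d) Lc j)) Lc S M
                  (W2SymOfK (unitK sf sm (GcombSh (d := d) Lc j)) Lc S M 0 M₂) μ (toSite r') ν u')
                + cB • B μ (toSite r') ν u') x z (Sum.inl α) (Sum.inl β) else 0)) κ κ' κ₂ κ₁
          + (fun μ ν α β : Fin (d + 1) => ∑ r' ∈ box (d + 1) P, ∑' u' : Site (d + 1), ∑' x : Site (d + 1), ∑' z : Site (d + 1),
            (if toSite r' μ % (P : ℤ) = (P : ℤ) - 1 ∧ u' ν % (P : ℤ) = (P : ℤ) - 1 ∧ x α % (P : ℤ) = (P : ℤ) - 1 ∧ z β % (P : ℤ) = (P : ℤ) - 1 then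
              (c • mmRead Lc (K3OfK (unitK sf sm (GcombSh (d := d) Lc j)) Lc S M
                  (W2SymOfK (unitK sf sm (GcombSh (d := d) Lc j)) Lc S M 0 M₂) μ (toSite r') ν u')
                + cB • B μ (toSite r') ν u') x z (Sum.inl α) (Sum.inl β) else 0)) κ' κ κ₂ κ₁)
        + ((fun μ ν α β : Fin (d + 1) => ∑ r' ∈ box (d + 1) P, ∑' u' : Site (d + 1), ∑' x : Site (d + 1), ∑' z : Site (d + 1),
            (if toSite r' μ % (P : ℤ) = (P : ℤ) - 1 ∧ u' ν % (P : ℤ) = (P : ℤ) - 1 ∧ x α % (P : ℤ) = (P : ℤ) - 1 ∧ z β % (P : ℤ) = (P : ℤ) - 1 then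
              (c • mmRead Lc (K3OfK (unitK sf sm (GcombSh (d := d) Lc j)) Lc S M
                  (W2SymOfK (unitK sf sm (GcombSh (d := d) Lc j)) Lc S M 0 M₂) μ (toSite r') ν u')
                + cB • B μ (toSite r') ν u') x z (Sum.inl α) (Sum.inl β) else 0)) κ' κ κ₂ κ₁
          + (fun μ ν α β : Fin (d + 1) => ∑ r' ∈ box (d + 1) P, ∑' u' : Site (d + 1), ∑' x : Site (d + 1), ∑' z : Site (d + 1),
            (if toSite r' μ % (P : ℤ) = (P : ℤ) - 1 ∧ u' ν % (P : ℤ) = (P : ℤ) - 1 ∧ x α % (P : ℤ) = (P : ℤ) - 1 ∧ z β % (P : ℤ) = (P : ℤ) - 1 then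
              (c • mmRead Lc (K3OfK (unitK sf sm (GcombSh (d := d) Lc j)) Lc S M
                  (W2SymOfK (unitK sf sm (GcombSh (d := d) Lc j)) Lc S M 0 M₂) μ (toSite r') ν u')
                + cB • B μ (toSite r') ν u') x z (Sum.inl α) (Sum.inl β) else 0)) κ κ' κ₂ κ₁))
          = T κ κ₁ κ' κ₂ + T κ' κ₁ κ κ₂ + (T κ κ₂ κ' κ₁ + T κ' κ₂ κ κ₁) := by
  obtain ⟨δ, C, hδ, _, hK⟩ := decays_GcombSh (d := d) Lc j
  exact forcingPairForm_of_ward (decays_unitK hK) hδ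
    (colH_ward_unitK (fun y κ u => colH_ward_GcombSh (d := d) (Lc := Lc) j y κ u) sf sm)
    (colM_ward_unitK (fun y ρ w => colM_GcombSh_ward (d := d) (Lc := Lc) j y ρ w) sf sm)
    (trK_combStep Lc sf sm j) (fun w z ρ μ hw => combStep_inr_inr_off Lc sf sm j w z ρ μ hw)
    (shiftK_unitK_of_shiftK (fun t => shiftK_GcombSh (d := d) Lc j t) sf sm) hP hS hδs hM hδM hSt hMt hSrow hMrow hM₂ hδ₂ hM₂t hBff c cB hL hR

end CombStep

end Summit.QuantumFields.BalabanUV.Beta.GAN24.ForcingPairFormOfWardLetters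

end
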